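import Summits.HodgeConjecture.HodgeConjecture.Theorems.K2LiuNonsplitSliceOfRankOneDecay   -- ★ (NS-i) (K2Liu-p04)
import Summits.HodgeConjecture.HodgeConjecture.Theorems.K2LiuNonsplitCartanDecayInert      -- ★ (D-n) (K2Liu-p04)
import Summits.HodgeConjecture.HodgeConjecture.Theorems.K2LiuInertCartanVolumes           -- ★ (26-n) inert unramified (K2Liu-p01): `exists_cartanVolumeDatum_inert`
import Summits.HodgeConjecture.HodgeConjecture.Theorems.K2LiuInertHeckeRecursion          -- ★ (K2Liu-p01): `natCard_residueField_eq_sq_inert`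
import Summits.HodgeConjecture.HodgeConjecture.Theorems.K2LiuSplitSliceIntegrable         -- ★ (K2Liu-p05): `rpow_norm_uniformizer_mul_pow_lt_one`
import Summits.HodgeConjecture.HodgeConjecture.Theorems.K2LiuSplitCosetCount              -- ★ (K2Liu-p05): `isCartanFamily_of_mulEquiv`, `mem_doubleCoset_symm_iff`

/-!
# The finite slice of #32dR at an INERT `v ∈ S` with unramified hyperbolic lattice — ASSEMBLED ((NS-i) + (26-n) + (D-n))

Track B ∕ K2-LIT, hLiu418 = stmt-HodgeConjecture-24832; socket #32dR `sig_K2LiuDoublingHeightDecayLocalR2` (U5d ED. 5 :554) through ★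
`K2LiuDoublingHeightDecayLocalR2OfNonsplitData.doublingHeightDecayLocalR2_of_nonsplitData` (K2Liu-p04, p857289): at a non-split `v ∈ S` the closer wants
`IsCompact univ ∨ ‹rank-one Cartan decay datum›`.  THIS FILE supplies the datum — hence the slice itself — at an INERT place `v` of `L⁺` UNRAMIFIED in `L`
where the place form of `diag dV` has an INTEGRAL HYPERBOLIC FRAME (`diag(dV)_w = σ_w(T)ᵀ·antidiag(1,1)·T`, `T ∈ GL₂(𝒪_w)`; the generator
`t₁ = T⁻¹·diag(ϖ,ϖ⁻¹)·T` with `σ_w ϖ = ϖ` — ★ #27i ∕ #28i frame, populated by ★ `exists_generator_inert`):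
**`integrable_placeSlice_inert`** — for `2·2 − 2 < τ` the slice `u ↦ Φ(ι(ιA placesEmbed_S(1, u at v), 1))^τ` is integrable on `U(H)(L⁺_v)` (any Haar `ν`,
any continuous height `Φ > 0` of type `(P_Δ, modDelta)`), and **`exists_rankOneDatum_inert`** — the datum in the exact `∃ K₀ tv C₁ Q C₂ r, …` shape of the
closer's `_hns`.  ASSEMBLY: ★ p01 `exists_cartanVolumeDatum_inert` on `U(diag dV)(L⁺_v)` for the Haar measure `ν ∘ κ_v⁻¹` (`κ_v = localCongr g⁻¹ … v`, ★ D5),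
transported to `U(H)(L⁺_v)` along `κ_v` (★ `isCartanFamily_of_mulEquiv`, ★ `mem_doubleCoset_symm_iff`, `Measure.map_apply`); decay ★ (D-n)
`exists_sliceDecay_cartan_inert` (`r = √‖ϖ‖_w`); threshold `√‖ϖ‖_w^τ · q_v² < 1 ⟺ τ > 2` by ★ p05 `rpow_norm_uniformizer_mul_pow_lt_one` at `N = 2` and ★ p01
`natCard_residueField_eq_sq_inert` (`#𝓀[L_w] = q_v²`); then ★ (NS-i) `integrable_placeSlice_of_rankOneDecay`.  Theorems only; no `sorry`; default heartbeats.
[GelbartPiatetskishapiroRallis1987, Part A §6]; [Li1992, §3 Thm. 3.1]; [Liu2011, §2C p. 863]; [Macdonald1995, Ch. V §2 (2.9)].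
HONEST LABEL: HC_CM is proved only modulo the 7 printed citations (2 remaining named inputs: hLiu418 = stmt-HodgeConjecture-24832, h413 =
stmt-HodgeConjecture-24833) until rung 0 closes; count-neutral helper toward #32dR (inert unramified-lattice places of `S`; the anisotropic, ramified and
non-unimodular non-split places remain named inputs of the closer), retires nothing by itself.
-/

set_option autoImplicit false
-- the mandated namespace repeats the single-problem summit's segment (`HodgeConjecture.HodgeConjecture`)
set_option linter.dupNamespace false

noncomputable section

open scoped Matrix ENNReal
open NumberField IsDedekindDomain MeasureTheory

namespace Summit.HodgeConjecture.HodgeConjecture.Cruxes.HLiu418.K2LiuNonsplitSliceInert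

open Literature.NumberTheory.Automorphic Literature.NumberTheory.Automorphic.UnitaryGroup
open Literature.NumberTheory.GelbartRogawski1991 Literature.NumberTheory.GelbartRogawski1991.GRConstruction
open Literature.NumberTheory.K2Lit.SiegelDoubled Literature.NumberTheory.K2Lit.PlaceSplitting
open Summit.HodgeConjecture.HodgeConjecture.Cruxes.HLiu418.K2LiuNonsplitSliceOfRankOneDecay
open Summit.HodgeConjecture.HodgeConjecture.Cruxes.HLiu418.K2LiuNonsplitCartanDecayInert
open Summit.HodgeConjecture.HodgeConjecture.Cruxes.HLiu418.K2LiuInertCartanVolumes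
open Summit.HodgeConjecture.HodgeConjecture.Cruxes.HLiu418.K2LiuInertHeckeRecursion
open Summit.HodgeConjecture.HodgeConjecture.Cruxes.HLiu418.K2LiuSplitSliceIntegrable
open Summit.HodgeConjecture.HodgeConjecture.Cruxes.HLiu418.K2LiuSplitCosetCount
open Summit.HodgeConjecture.HodgeConjecture.Cruxes.HLiu418.K2LiuDoublingHeckeCartanSum
open Summit.HodgeConjecture.HodgeConjecture.Cruxes.HLiu418.K2LiuDoublingSliceLocalBridge
open Summit.HodgeConjecture.HodgeConjecture.Cruxes.HLiu418.K2LiuSplitSliceOfTorusDecay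

variable (L : Type) [Field L] [NumberField L] [IsCMField L]
variable {n : ℕ} (e : Fin 2 × Fin 1 ≃ Fin n)
  (dV : Fin 2 → L) (hdV : ∀ i, IsCMField.complexConj L (dV i) = dV i)
  (dW : Fin 1 → L) (hdW : ∀ i, IsCMField.complexConj L (dW i) = dW i)
  (H : Matrix (Fin 2) (Fin 2) L) (t : L) (ht : t ≠ 0) (g : GL (Fin 2) L)
  (hg : formCongr ((IsCMField.complexConj L : L ≃ₐ[↥(maximalRealSubfield L)] L) : L →+* L) g (t • H) = Matrix.diagonal dV)
  (ιA : (UnitaryGroup.adelicGroupData (Fp L) L (IsCMField.complexConj L) 2 H).Adelic →*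
    UnitaryGroup.adelic (Fp L) L (IsCMField.complexConj L) 2 (Matrix.diagonal dV))
  (hιA : ∀ k, ((ιA k : ↥(UnitaryGroup.adelic (Fp L) L (IsCMField.complexConj L) 2 (Matrix.diagonal dV))) :
        GL (Fin 2) (AdeleRing (𝓞 L) L)) =
      (toAdeleGL L g)⁻¹ * UnitaryGroup.adelicVal (Fp L) L (IsCMField.complexConj L) 2 H k * toAdeleGL L g)
  (S : Finset (HeightOneSpectrum (𝓞 (Fp L)))) [DecidableEq (HeightOneSpectrum (𝓞 (Fp L)))]

omit [IsCMField L] [DecidableEq (HeightOneSpectrum (𝓞 (Fp L)))] in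
/-- the sharp-exponent numerics at an inert unramified place: `(√‖ϖ‖_w)^τ · q_v² < 1` for `τ > 2` (`‖ϖ‖_w = q_w⁻¹`, `q_w = q_v²`).
[cite: Li1992, §3 Thm. 3.1] [cite: NeukirchANT1999, Ch. I §8 Prop. (8.2)] -/
theorem sqrt_norm_pow_mul_sq_lt_one [IsCMField L] (v : HeightOneSpectrum (𝓞 (Fp L))) (w : UnitaryGroup.PlacesOver L v)
    (hw : IsCMField.complexConj L • w.1 = w.1) (hv : Algebra.IsUnramifiedIn (𝓞 L) v.asIdeal)
    {ϖ : w.1.adicCompletion L} (hϖ : Valued.v ϖ = WithZero.exp (-1 : ℤ)) {τ : ℝ} (hτ : 2 * (2 : ℝ) - 2 < τ) :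
    Real.sqrt ‖ϖ‖ ^ τ * (v.residueCard : ℝ) ^ 2 < 1 := by
  have hτ0 : 0 < τ := by linarith
  have h := rpow_norm_uniformizer_mul_pow_lt_one L (N := 2) hϖ hτ0 hτ
  -- `#𝓀[L_w] = q_w = q_v²`
  have hQ' : w.1.residueCard = v.residueCard ^ 2 := by
    have h1 := natCard_residueField_eq_sq_inert L v w hw hv
    rwa [IsDedekindDomain.HeightOneSpectrum.natCard_residueField_adicCompletion L w.1, ← HeightOneSpectrum.residueCard_eq_card_quotient] at h1
  rw [natCard_valuativeResidueField_adicCompletion_eq L w.1, hQ'] at h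
  have h2 : (((v.residueCard ^ 2 : ℕ) : ℝ)) ^ (2 - 1) = (v.residueCard : ℝ) ^ 2 := by norm_num
  have h3 : ‖ϖ‖ ^ (((1 : ℕ) : ℝ) / 2) = Real.sqrt ‖ϖ‖ := by rw [Real.sqrt_eq_rpow]; norm_num
  rwa [h2, h3] at h

/-! ## Generic coercion bookkeeping for `≃ₜ*` (kept generic so that no transport ever unfolds the local congruence) -/

/-- `⇑e.toMulEquiv = ⇑e`. [cite: PlatonovRapinchuk1994, §2.3] -/
theorem cme_coe_toMulEquiv {M N : Type*} [Mul M] [Mul N] [TopologicalSpace M] [TopologicalSpace N] (f : M ≃ₜ* N) :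
    ⇑f.toMulEquiv = ⇑f := rfl

/-- `e.toMulEquiv.symm y = e.symm y`. [cite: PlatonovRapinchuk1994, §2.3] -/
theorem cme_toMulEquiv_symm_apply {M N : Type*} [Mul M] [Mul N] [TopologicalSpace M] [TopologicalSpace N] (f : M ≃ₜ* N) (y : N) :
    f.toMulEquiv.symm y = f.symm y := rfl

include ht hg hιA in
/-- **THE RANK-ONE CARTAN DECAY DATUM AT AN INERT UNRAMIFIED-LATTICE PLACE**, in the exact shape of the closer's `_hns` (★
`doublingHeightDecayLocalR2_of_nonsplitData`): `K₀ = κ_v⁻¹(U(diag dV)(𝒪_v))`, `tv m = κ_v⁻¹(t₁^m)`, `Q = q_v²`, `r = √‖ϖ‖_w`.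
[cite: GelbartPiatetskishapiroRallis1987, Part A §6] [cite: Li1992, §3 Thm. 3.1] [cite: Macdonald1995, Ch. V §2 (2.9)] -/
theorem exists_rankOneDatum_inert (vS : S)
    [MeasurableSpace (UnitaryGroup.localPi L (IsCMField.complexConj L) 2 H vS.1)]
    [BorelSpace (UnitaryGroup.localPi L (IsCMField.complexConj L) 2 H vS.1)]
    [MeasurableSpace (UnitaryGroup.localPi L (IsCMField.complexConj L) 2 (Matrix.diagonal dV) vS.1)]
    [BorelSpace (UnitaryGroup.localPi L (IsCMField.complexConj L) 2 (Matrix.diagonal dV) vS.1)]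
    (ν : Measure (UnitaryGroup.localPi L (IsCMField.complexConj L) 2 H vS.1)) [ν.IsHaarMeasure]
    {Φ : HA L e dV hdV dW hdW → ℝ} (hΦc : Continuous Φ) (hΦpos : ∀ x, 0 < Φ x)
    (hΦ : ∀ p x : HA L e dV hdV dW hdW, IsSiegelDelta L e dV hdV dW hdW p →
      Φ (p * x) = modDelta L e dV hdV dW hdW p * Φ x)
    -- the inert place data (★ #27i ∕ #28i frame)
    (w : UnitaryGroup.PlacesOver L vS.1) (hw : IsCMField.complexConj L • w.1 = w.1) (hv : Algebra.IsUnramifiedIn (𝓞 L) vS.1.asIdeal)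
    {ϖ : w.1.adicCompletion L} (hϖ : Valued.v ϖ = WithZero.exp (-1 : ℤ))
    (hϖσ : galAdicCompletionMap (L := L) (IsCMField.complexConj L) hw ϖ = ϖ)
    (T : GL (Fin 2) (w.1.adicCompletion L)) (hTi : T ∈ glInt 2 (w.1.adicCompletion L))
    (hTJ : UnitaryGroup.placeForm (Matrix.diagonal dV) w.1 =
      formCongr (galAdicCompletionMap (L := L) (IsCMField.complexConj L) hw) T ((StdForm.antidiagonal 2).over (w.1.adicCompletion L)))
    (t₁ : UnitaryGroup.localPi L (IsCMField.complexConj L) 2 (Matrix.diagonal dV) vS.1)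
    (ht₁ : Units.val ((t₁ : UnitaryGroup.LocalGLPi L 2 vS.1) w) =
      ((T⁻¹ : GL (Fin 2) (w.1.adicCompletion L)) : Matrix (Fin 2) (Fin 2) (w.1.adicCompletion L)) *
        Matrix.diagonal ![ϖ, ϖ⁻¹] * (T : Matrix (Fin 2) (Fin 2) (w.1.adicCompletion L)))
    {τ : ℝ} (hτ : 2 * (2 : ℝ) - 2 < τ) :
    ∃ (K₀ : Subgroup (UnitaryGroup.localPi L (IsCMField.complexConj L) 2 H vS.1))
      (tv : ℕ → UnitaryGroup.localPi L (IsCMField.complexConj L) 2 H vS.1) (C₁ Q C₂ r : ℝ),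
      IsOpen (K₀ : Set (UnitaryGroup.localPi L (IsCMField.complexConj L) 2 H vS.1)) ∧
      IsCompact (K₀ : Set (UnitaryGroup.localPi L (IsCMField.complexConj L) 2 H vS.1)) ∧
      IsCartanFamily K₀ tv ∧ 0 ≤ Q ∧ 0 ≤ C₂ ∧ 0 ≤ r ∧ r ^ τ * Q < 1 ∧
      (∀ m, (ν (DoubleCoset.doubleCoset (tv m) (K₀ : Set _) K₀)).toReal ≤ C₁ * Q ^ m) ∧
      (∀ m, Φ (iotaLeft L e dV hdV dW hdW (ιA (placesEmbed L H S (1, Pi.mulSingle vS (tv m))))) ≤ C₂ * r ^ m) := by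
  -- the local congruence `κ_v : U(H)(L⁺_v) ≃ₜ* U(diag dV)(L⁺_v)` and the transported Haar measure
  set κ := localCongr L (IsCMField.complexConj L) g⁻¹ (inv_ne_zero ht) (formCongr_inv_inv_smul L H dV t ht g hg) vS.1 with hκ
  haveI : (ν.map κ).IsHaarMeasure := κ.isHaarMeasure_map ν
  -- p01's row-26 datum on `U(diag dV)(L⁺_v)` and the (D-n) decay
  obtain ⟨K, tv, C₁, Q, -, -, hKo, hKc, hcart, hQ, hQ0, -, htvw, hvol⟩ :=
    exists_cartanVolumeDatum_inert L dV vS.1 w hw hv hϖ hϖσ T hTi hTJ t₁ ht₁ (ν.map κ)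
  -- transport of the datum along `κ_v` (everything in the `κ.toMulEquiv` currency; only generic coercion lemmas touch `κ`)
  have hκc : Continuous (κ.toMulEquiv : UnitaryGroup.localPi L (IsCMField.complexConj L) 2 H vS.1 →
      UnitaryGroup.localPi L (IsCMField.complexConj L) 2 (Matrix.diagonal dV) vS.1) := by
    rw [cme_coe_toMulEquiv]; exact map_continuous κ
  have hκsc : Continuous (κ.toMulEquiv.symm : UnitaryGroup.localPi L (IsCMField.complexConj L) 2 (Matrix.diagonal dV) vS.1 →
      UnitaryGroup.localPi L (IsCMField.complexConj L) 2 H vS.1) := by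
    have h : (κ.toMulEquiv.symm : _ → _) = κ.symm := funext fun y => cme_toMulEquiv_symm_apply κ y
    rw [h]; exact map_continuous κ.symm
  let K₀ : Subgroup (UnitaryGroup.localPi L (IsCMField.complexConj L) 2 H vS.1) := K.comap κ.toMulEquiv.toMonoidHom
  -- (membership and preimage conversions go through LEMMAS, never through definitional unfolding: the kernel must not be asked to
  --  compare `U(H)(L⁺_v)` with `U(diag dV)(L⁺_v)`)
  have hKK : ∀ x, κ.toMulEquiv x ∈ K ↔ x ∈ K₀ := fun x => by
    rw [Subgroup.mem_comap, MulEquiv.coe_toMonoidHom]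
  have hK₀set : (K₀ : Set (UnitaryGroup.localPi L (IsCMField.complexConj L) 2 H vS.1)) = κ.toMulEquiv ⁻¹' (K : Set _) :=
    Set.ext fun x => (hKK x).symm.trans Set.mem_preimage.symm
  have hK₀o : IsOpen (K₀ : Set (UnitaryGroup.localPi L (IsCMField.complexConj L) 2 H vS.1)) := by
    rw [hK₀set]; exact hKo.preimage hκc
  have hK₀c : IsCompact (K₀ : Set (UnitaryGroup.localPi L (IsCMField.complexConj L) 2 H vS.1)) := by
    have himg : (K₀ : Set (UnitaryGroup.localPi L (IsCMField.complexConj L) 2 H vS.1)) = κ.toMulEquiv.symm '' (K : Set _) := by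
      rw [hK₀set]
      ext x
      constructor
      · intro hx
        exact ⟨κ.toMulEquiv x, Set.mem_preimage.1 hx, κ.toMulEquiv.symm_apply_apply x⟩
      · rintro ⟨y, hy, rfl⟩
        refine Set.mem_preimage.2 ?_
        rw [MulEquiv.apply_symm_apply]
        exact hy
    rw [himg]
    exact hKc.image hκsc
  have hcart' : IsCartanFamily K₀ (fun m => κ.toMulEquiv.symm (tv m)) := isCartanFamily_of_mulEquiv κ.toMulEquiv hKK hcart
  have hvol' : ∀ m, (ν (DoubleCoset.doubleCoset (κ.toMulEquiv.symm (tv m)) (K₀ : Set _) K₀)).toReal ≤ C₁ * Q ^ m := by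
    intro m
    have hset : DoubleCoset.doubleCoset (κ.toMulEquiv.symm (tv m)) (K₀ : Set _) K₀ =
        κ.toMulEquiv ⁻¹' DoubleCoset.doubleCoset (tv m) (K : Set _) K := by
      exact Set.ext fun x => (mem_doubleCoset_symm_iff κ.toMulEquiv hKK (tv m) x).trans Set.mem_preimage.symm
    have hmap : (ν.map κ) (DoubleCoset.doubleCoset (tv m) (K : Set _) K) = ν (κ.toMulEquiv ⁻¹' DoubleCoset.doubleCoset (tv m) (K : Set _) K) := by
      rw [← cme_coe_toMulEquiv, Measure.map_apply hκc.measurable (measurableSet_doubleCoset hKo (tv m))]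
    rw [hset, ← hmap]
    exact hvol m
  -- the decay along `κ⁻¹ ∘ tv`, read in the `H`-frame through ★ p05's slice-point identity
  obtain ⟨C₂, hC₂, hdec⟩ := exists_decay_cartan_inert L e dV hdV dW hdW vS.1 w hw hϖ hϖσ T hTi hTJ tv htvw hΦc hΦpos hΦ
  have hdec' : ∀ m, Φ (iotaLeft L e dV hdV dW hdW (ιA (placesEmbed L H S (1, Pi.mulSingle vS (κ.toMulEquiv.symm (tv m)))))) ≤
      C₂ * Real.sqrt ‖ϖ‖ ^ m := by
    intro m
    rw [iotaLeft_iotaA_placesEmbed_mulSingle L e dV hdV dW hdW H t ht g hg ιA hιA S vS, ← hκ, ← cme_coe_toMulEquiv, MulEquiv.apply_symm_apply]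
    exact (hdec m).1
  refine ⟨K₀, fun m => κ.toMulEquiv.symm (tv m), C₁, Q, C₂, Real.sqrt ‖ϖ‖, hK₀o, hK₀c, hcart', hQ0, hC₂.le, Real.sqrt_nonneg _, ?_, hvol',
    hdec'⟩
  rw [hQ]
  exact sqrt_norm_pow_mul_sq_lt_one L vS.1 w hw hv hϖ hτ

include ht hg hιA in
/-- **THE FINITE SLICE OF #32dR AT AN INERT UNRAMIFIED-LATTICE PLACE `v ∈ S`**: for `2·2 − 2 < τ`, `u ↦ Φ(ι(ιA placesEmbed_S(1, u at v), 1))^τ` is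
integrable on `U(H)(L⁺_v)` — `_hfin v` of ★ (R) ∕ ★ (α) at such a place ((NS-i) fed with `exists_rankOneDatum_inert`).
[cite: GelbartPiatetskishapiroRallis1987, Part A §6] [cite: Li1992, §3 Thm. 3.1] [cite: Liu2011, §2C p. 863] [cite: Macdonald1995, Ch. V §2 (2.9)] -/
theorem integrable_placeSlice_inert (hdV0 : ∀ i, dV i ≠ 0) (hdW0 : ∀ i, dW i ≠ 0) (vS : S)
    [MeasurableSpace (UnitaryGroup.localPi L (IsCMField.complexConj L) 2 H vS.1)]
    [BorelSpace (UnitaryGroup.localPi L (IsCMField.complexConj L) 2 H vS.1)]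
    [MeasurableSpace (UnitaryGroup.localPi L (IsCMField.complexConj L) 2 (Matrix.diagonal dV) vS.1)]
    [BorelSpace (UnitaryGroup.localPi L (IsCMField.complexConj L) 2 (Matrix.diagonal dV) vS.1)]
    (ν : Measure (UnitaryGroup.localPi L (IsCMField.complexConj L) 2 H vS.1)) [ν.IsHaarMeasure]
    {Φ : HA L e dV hdV dW hdW → ℝ} (hΦc : Continuous Φ) (hΦpos : ∀ x, 0 < Φ x)
    (hΦ : ∀ p x : HA L e dV hdV dW hdW, IsSiegelDelta L e dV hdV dW hdW p →
      Φ (p * x) = modDelta L e dV hdV dW hdW p * Φ x)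
    (w : UnitaryGroup.PlacesOver L vS.1) (hw : IsCMField.complexConj L • w.1 = w.1) (hv : Algebra.IsUnramifiedIn (𝓞 L) vS.1.asIdeal)
    {ϖ : w.1.adicCompletion L} (hϖ : Valued.v ϖ = WithZero.exp (-1 : ℤ))
    (hϖσ : galAdicCompletionMap (L := L) (IsCMField.complexConj L) hw ϖ = ϖ)
    (T : GL (Fin 2) (w.1.adicCompletion L)) (hTi : T ∈ glInt 2 (w.1.adicCompletion L))
    (hTJ : UnitaryGroup.placeForm (Matrix.diagonal dV) w.1 =
      formCongr (galAdicCompletionMap (L := L) (IsCMField.complexConj L) hw) T ((StdForm.antidiagonal 2).over (w.1.adicCompletion L)))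
    (t₁ : UnitaryGroup.localPi L (IsCMField.complexConj L) 2 (Matrix.diagonal dV) vS.1)
    (ht₁ : Units.val ((t₁ : UnitaryGroup.LocalGLPi L 2 vS.1) w) =
      ((T⁻¹ : GL (Fin 2) (w.1.adicCompletion L)) : Matrix (Fin 2) (Fin 2) (w.1.adicCompletion L)) *
        Matrix.diagonal ![ϖ, ϖ⁻¹] * (T : Matrix (Fin 2) (Fin 2) (w.1.adicCompletion L)))
    {τ : ℝ} (hτ : 2 * (2 : ℝ) - 2 < τ) :
    Integrable (fun u => Φ (iotaLeft L e dV hdV dW hdW (ιA (placesEmbed L H S (1, Pi.mulSingle vS u)))) ^ τ) ν := by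
  obtain ⟨K₀, tv, C₁, Q, C₂, r, hK₀o, hK₀c, htv, hQ, hC₂, hr, hrQ, hvol, hdec⟩ :=
    exists_rankOneDatum_inert L e dV hdV dW hdW H t ht g hg ιA hιA S vS ν hΦc hΦpos hΦ w hw hv hϖ hϖσ T hTi hTJ t₁ ht₁ hτ
  exact integrable_placeSlice_of_rankOneDecay L e dV hdV dW hdW H t ht g hg ιA hιA S hdV0 hdW0 vS ν hΦc hΦpos hΦ hK₀o hK₀c htv hQ hvol
    (by linarith) hC₂ hr hrQ hdec

end Summit.HodgeConjecture.HodgeConjecture.Cruxes.HLiu418.K2LiuNonsplitSliceInert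

end
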